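import Mathlib
import HarnessLib
import Summits.MatrixMultiplication.MatrixMultiplication.Theorems.FarEdgeDescentAllArities
import Summits.MatrixMultiplication.MatrixMultiplication.Theorems.FarEdgeDescentDialStaircase
import Summits.MatrixMultiplication.MatrixMultiplication.Theorems.FarEdgeDescentChordSplit
import Summits.MatrixMultiplication.MatrixMultiplication.Theorems.FarEdgeDescentCornerLemmas

/-!
# Far-edge descent — the open corner `(199/100, 2)` of the dial, symbolically (kernel XLVIII, lens-2 g63)

Kernel XLVII (`FarEdgeDescentChordSplit`) reduced the region criterion at any dial to two POLYNOMIAL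
conditions (I) `D ≤ (16/25)·min(A,B)` and (II) `D ≤ (9/25)·min(A,B) + (7/50)·max(A,B)` on the pinned
two-factor region.  This file PROVES (I) and (II) — hence the region criterion, hence the cap law
XL-D(a, β) for every `a ≥ 2` — on the whole corner `199/100 ≤ β < 2`, with NO certificate: for each `β`
the regulariser is `ε = (2−β)²/32`, `z = 1/(1+ε)` (so the mixed weight `w = 1 − z(1+ε)` vanishes and
`D = z·λλ'αα'`), and the floor depth `m` is taken with `2^{−(m+2)} < (2−β)/64 ≤ 2^{−(m+1)}`, which makes
the product floor at least `(12/25)(2−β)` (`Vfloor_corner_lower`).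

The proof is four elementary lemmas (`FarEdgeDescentCornerLemmas`).  Per factor (pin `|1 − (2β−1)λ| ≤ V²` only):
`lemma_I` — `z λ α ≤ (16/25)(1 − (β−1)λ)` (needs `β ≥ 25/16`; a discriminant);
`lemma_U` — the GAIN inequality `β(2+V)·λα ≤ 2(1+ε)(1 − (β−1)λ)` (an explicit sum of squares
`β(1−ε)(1−V)² V + ((2−β) − 2ε(3β−1))V² + βV⁴`, needs `2ε(3β−1) ≤ 2−β`);
`lemma_U'` — its sharpening `β((1+ε) + (1−4(2−β))V)·λα ≤ (1+ε)²(1 − (β−1)λ)` on the deep range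
`V ≤ 4(2−β)`; and for the pair, `exclusion_sum` — on the deep range the product-floor exclusion
`V_P ≥ V_f` forces `V + V' ≥ (293/100)·V_f`.  Then (I) is `lemma_I × (λα ≥ 0)`; (II) is `lemma_U` on both
factors when one of them has `V ≥ 4(2−β)`, and `lemma_U'` on both plus `exclusion_sum` when both are deep
(`pair_II`).  Consequence (`capXLD_allA_corner`): XL-D(a, β) for all `a ≥ 2`, `199/100 ≤ β < 2` — the
corner that the certificate staircase cannot reach (kernel XLIV) is closed by hand.  No `sorry`, no new
definitions.
-/

noncomputable section

set_option linter.dupNamespace false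
set_option linter.style.longLine false

namespace Summit.MatrixMultiplication.MatrixMultiplication.Theorems.FarEdgeDescentCornerSymbolic

open Finset
open Summit.MatrixMultiplication.MatrixMultiplication.Theorems.FarEdgeDescentFloorDial
open Summit.MatrixMultiplication.MatrixMultiplication.Theorems.FarEdgeDescentFloorDial.Sched
open Summit.MatrixMultiplication.MatrixMultiplication.Theorems.FarEdgeDescentNarrownessPotential
open Summit.MatrixMultiplication.MatrixMultiplication.Theorems.FarEdgeDescentFloorNarrowness
open Summit.MatrixMultiplication.MatrixMultiplication.Theorems.FarEdgeDescentAllArities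
open Summit.MatrixMultiplication.MatrixMultiplication.Theorems.FarEdgeDescentDialStaircase
open Summit.MatrixMultiplication.MatrixMultiplication.Theorems.FarEdgeDescentChordSplit
open Summit.MatrixMultiplication.MatrixMultiplication.Theorems.FarEdgeDescentCornerLemmas

/-! ## 3. The floor on the corner -/

/-- The floor dominates its unsaturated top term: `z^m (1 − τ'_{m+2}) ≤ Vfloor a β z m` (`0 ≤ z ≤ 1`). -/
theorem tail_le_Vfloor (a β : ℝ) {z : ℝ} (hz0 : 0 ≤ z) (hz1 : z ≤ 1) (m : ℕ) :
    z ^ m * (1 - tauP a β (m + 2)) ≤ Vfloor a β z m := by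
  unfold Vfloor
  have hτ1 : ∀ j : ℕ, tauP a β j ≤ 1 := fun j => min_le_left _ _
  have hS : (1 - z) * ∑ k ∈ range m, tauP a β (k + 2) * z ^ k ≤ (1 - z) * ∑ k ∈ range m, z ^ k := by
    apply mul_le_mul_of_nonneg_left _ (by linarith)
    apply sum_le_sum
    intro k _
    have := mul_le_mul_of_nonneg_right (hτ1 (k + 2)) (pow_nonneg hz0 k)
    simpa using this
  have hg := geom_sum_mul_neg z m
  have hE : (1 - z) * ∑ k ∈ range m, z ^ k = 1 - z ^ m := by rw [← hg]; ring
  nlinarith [hS, hE]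

/-- Below the stair of depth `j`: `((2−β) − 2^{−j})/2 ≤ 1 − τ'_j(2, β)` when `2^{−j} ≤ 2 − β`. -/
theorem one_sub_tauP_ge {β : ℝ} {j : ℕ} (hq : (2 : ℝ)⁻¹ ^ j ≤ 2 - β) :
    ((2 - β) - (2 : ℝ)⁻¹ ^ j) / 2 ≤ 1 - tauP 2 β j := by
  have hq0 : 0 ≤ (2 : ℝ)⁻¹ ^ j := by positivity
  have hq1 : (2 : ℝ)⁻¹ ^ j ≤ 1 := pow_le_one₀ (by norm_num) (by norm_num)
  have hD : 0 < 2 - (2 : ℝ)⁻¹ ^ j := by linarith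
  rw [tauP_eq_div_of_le (by norm_num : (1:ℝ) ≤ 2) (by linarith : β ≤ 2 - (2 : ℝ)⁻¹ ^ j)]
  have ht1 : β / (2 - (2 : ℝ)⁻¹ ^ j) ≤ 1 := (div_le_one hD).mpr (by linarith)
  have ht : β / (2 - (2 : ℝ)⁻¹ ^ j) * (2 - (2 : ℝ)⁻¹ ^ j) = β := div_mul_cancel₀ β hD.ne'
  have htq := mul_le_mul_of_nonneg_right ht1 hq0
  rw [div_le_iff₀ (by norm_num : (0:ℝ) < 2)]
  nlinarith [ht, htq]

set_option maxHeartbeats 1000000 in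
/-- **The corner floor.**  For `199/100 ≤ β < 2`, `ε = (2−β)²/32`, `z(1+ε) = 1` there is a depth `m` with
`(12/25)(2−β) ≤ Vfloor 2 β z m` (take `2^{−(m+2)} < (2−β)/64 ≤ 2^{−(m+1)}`: then `1 − τ'_{m+2} ≥ (63/128)(2−β)`
and `z^m ≥ 1 − m(1−z) ≥ 1 − 2(2−β)`). -/
theorem Vfloor_corner_lower {β z ε : ℝ} (hβ : 199 / 100 ≤ β) (hβ2 : β < 2) (hε : ε = (2 - β) ^ 2 / 32)
    (hzε : z * (1 + ε) = 1) : ∃ m : ℕ, 12 / 25 * (2 - β) ≤ Vfloor 2 β z m := by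
  have hδ0 : 0 < 2 - β := by linarith
  have hδ1 : 2 - β ≤ 1 / 100 := by linarith
  have hε0 : 0 ≤ ε := by rw [hε]; positivity
  have hz0 : 0 < z := by nlinarith
  have hz1 : z ≤ 1 := by nlinarith
  have h1z : 1 - z ≤ ε := by nlinarith
  -- n with 2^n ≤ 64/(2−β) < 2^(n+1)
  have h64 : (6400 : ℝ) ≤ 64 / (2 - β) := by rw [le_div_iff₀ hδ0]; nlinarith
  obtain ⟨n, hn1, hn2⟩ := exists_nat_pow_near (by linarith : (1:ℝ) ≤ 64 / (2 - β)) (by norm_num : (1:ℝ) < 2)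
  have hn0 : n ≠ 0 := by
    rintro rfl
    norm_num at hn2
    linarith
  obtain ⟨m, rfl⟩ := Nat.exists_eq_succ_of_ne_zero hn0
  refine ⟨m, ?_⟩
  have hn2' : 64 / (2 - β) < (2 : ℝ) ^ (m + 2) := hn2
  have hn1' : (2 : ℝ) ^ (m + 1) ≤ 64 / (2 - β) := hn1
  -- 2⁻¹^(m+2) < (2−β)/64
  have hq : (2 : ℝ)⁻¹ ^ (m + 2) < (2 - β) / 64 := by
    have h2 : (0:ℝ) < 2 ^ (m + 2) := by positivity
    have h64p : (0:ℝ) < 64 / (2 - β) := by positivity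
    rw [inv_pow]
    calc ((2:ℝ) ^ (m + 2))⁻¹ < (64 / (2 - β))⁻¹ := (inv_lt_inv₀ h2 h64p).mpr hn2'
      _ = (2 - β) / 64 := inv_div _ _
  have hq' : (2 : ℝ)⁻¹ ^ (m + 2) ≤ 2 - β := by linarith [hq, hδ0]
  have hτ := one_sub_tauP_ge hq'
  have hτ' : 63 / 128 * (2 - β) ≤ 1 - tauP 2 β (m + 2) := by linarith
  -- z^m ≥ 1 − m(1−z) ≥ 1 − 2(2−β)
  have hmle : (m : ℝ) ≤ 64 / (2 - β) := by
    have h1 : (m : ℝ) ≤ ((m + 1 : ℕ) : ℝ) := by exact_mod_cast Nat.le_succ m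
    have h2 : ((m + 1 : ℕ) : ℝ) < (2 : ℝ) ^ (m + 1) := by exact_mod_cast Nat.lt_two_pow_self
    exact (h1.trans_lt (h2.trans_le hn1')).le
  have hbern : 1 + (m : ℝ) * (z - 1) ≤ z ^ m := by
    have := one_add_mul_le_pow (by linarith : (-2 : ℝ) ≤ z - 1) m
    simpa using this
  have hmz : (m : ℝ) * (1 - z) ≤ 2 * (2 - β) := by
    calc (m : ℝ) * (1 - z) ≤ 64 / (2 - β) * ε := mul_le_mul hmle h1z (by linarith) (by positivity)
      _ = 2 * (2 - β) := by rw [hε]; field_simp; ring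
  have hzm : 49 / 50 ≤ z ^ m := by nlinarith
  have htail := tail_le_Vfloor 2 β hz0.le hz1 m
  have : 49 / 50 * (63 / 128 * (2 - β)) ≤ z ^ m * (1 - tauP 2 β (m + 2)) :=
    mul_le_mul hzm hτ' (by nlinarith) (by linarith)
  linarith

/-! ## 4. The corner: the chord conditions, hence the region criterion and the cap law -/

set_option maxHeartbeats 1000000 in
/-- **The chord conditions (I), (II) hold on the corner** `199/100 ≤ β < 2` for the regulariser
`ε = (2−β)²/32`, `z = 1/(1+ε)` and the floor depth of `Vfloor_corner_lower` — exactly the hypothesis of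
`FarEdgeDescentChordSplit.capXLD_corner_of_chordConditions`. -/
theorem chordConditions_corner : ∀ β : ℝ, 199 / 100 ≤ β → β < 2 → ∃ z ε : ℝ, ∃ m : ℕ, 9 / 10 ≤ z ∧ z ≤ 1 ∧ 0 < ε ∧
      ∀ lam lam' V V' VP : ℝ,
        0 < lam → β * lam ≤ 1 → 0 < lam' → β * lam' ≤ 1 →
        Vfloor 2 β z m ≤ V → V ≤ 1 → Vfloor 2 β z m ≤ V' → V' ≤ 1 →
        β * ((2 * β - 1) * lam - 1) ≤ (β - 1) * V → β * ((2 * β - 1) * lam' - 1) ≤ (β - 1) * V' →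
        |1 - (2 * β - 1) * lam| ≤ V ^ 2 → |1 - (2 * β - 1) * lam'| ≤ V' ^ 2 →
        VP * (lam + lam' - (2 * β - 1) * lam * lam') =
          lam' * (1 - β * lam) * V' + lam * (1 - β * lam') * V + z * lam * lam' * V * V' →
        Vfloor 2 β z m ≤ VP →
        lam * lam' * (z * (ε + 1 - V) * (ε + 1 - V') +
            (1 - z * (1 + ε)) * ((ε + 1 - V) + (ε + 1 - V') - 1 - ε)) ≤
          16 / 25 * ((1 - (β - 1) * lam') * (lam * (ε + 1 - V))) ∧
        lam * lam' * (z * (ε + 1 - V) * (ε + 1 - V') +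
            (1 - z * (1 + ε)) * ((ε + 1 - V) + (ε + 1 - V') - 1 - ε)) ≤
          16 / 25 * ((1 - (β - 1) * lam) * (lam' * (ε + 1 - V'))) ∧
        lam * lam' * (z * (ε + 1 - V) * (ε + 1 - V') +
            (1 - z * (1 + ε)) * ((ε + 1 - V) + (ε + 1 - V') - 1 - ε)) ≤
          9 / 25 * ((1 - (β - 1) * lam') * (lam * (ε + 1 - V))) +
            7 / 50 * ((1 - (β - 1) * lam) * (lam' * (ε + 1 - V'))) ∧
        lam * lam' * (z * (ε + 1 - V) * (ε + 1 - V') +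
            (1 - z * (1 + ε)) * ((ε + 1 - V) + (ε + 1 - V') - 1 - ε)) ≤
          9 / 25 * ((1 - (β - 1) * lam) * (lam' * (ε + 1 - V'))) +
            7 / 50 * ((1 - (β - 1) * lam') * (lam * (ε + 1 - V))) := by
  intro β hβ hβ2
  have hδ0 : 0 < 2 - β := by linarith
  have hδ1 : 2 - β ≤ 1 / 100 := by linarith
  set ε := (2 - β) ^ 2 / 32 with hε
  have hε0 : 0 < ε := by positivity
  have hε1 : ε ≤ 1 / 100 := by rw [hε]; nlinarith
  set z := 1 / (1 + ε) with hz
  have hzε : z * (1 + ε) = 1 := by rw [hz]; field_simp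
  have hz1 : z ≤ 1 := by rw [hz, div_le_one (by linarith)]; linarith
  have hz9 : 9 / 10 ≤ z := by rw [hz, le_div_iff₀ (by linarith)]; linarith
  obtain ⟨m, hVf⟩ := Vfloor_corner_lower hβ hβ2 hε hzε
  refine ⟨z, ε, m, hz9, hz1, hε0, ?_⟩
  intro l l' V V' VP hl hl1 hl' hl'1 hV0 hV1 hV'0 hV'1 hwl hwl' hp hp' hP hVP
  set Vf := Vfloor 2 β z m with hVfdef
  have hVpos : 0 ≤ V := by linarith
  have hV'pos : 0 ≤ V' := by linarith
  have hVf0 : 0 ≤ Vf := by linarith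
  obtain ⟨hpL, hpU⟩ := abs_le.mp hp
  obtain ⟨hpL', hpU'⟩ := abs_le.mp hp'
  have hpin : (2 * β - 1) * l ≤ 1 + V ^ 2 := by linarith
  have hpin' : (2 * β - 1) * l' ≤ 1 + V' ^ 2 := by linarith
  have hla : 0 ≤ l * (ε + 1 - V) := mul_nonneg hl.le (by linarith)
  have hl'a : 0 ≤ l' * (ε + 1 - V') := mul_nonneg hl'.le (by linarith)
  have hw : 1 - z * (1 + ε) = 0 := by rw [hzε]; ring
  have eD : l * l' * (z * (ε + 1 - V) * (ε + 1 - V') +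
      (1 - z * (1 + ε)) * ((ε + 1 - V) + (ε + 1 - V') - 1 - ε)) = z * l * l' * (ε + 1 - V) * (ε + 1 - V') := by
    rw [hw]; ring
  rw [eD]
  -- per-factor lemmas
  have hεU : 2 * ε * (3 * β - 1) ≤ 2 - β := by nlinarith
  have hI1 := lemma_I (by linarith) hβ2.le hzε hz9 hε0.le hVpos hV1 hpin
  have hI2 := lemma_I (by linarith) hβ2.le hzε hz9 hε0.le hV'pos hV'1 hpin'
  have hU1 := lemma_U (by linarith) hε0.le hεU hVpos hV1 hpin
  have hU2 := lemma_U (by linarith) hε0.le hεU hV'pos hV'1 hpin'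
  have hU'1 : V ≤ 4 * (2 - β) →
      β * ((1 + ε) + (1 - 4 * (2 - β)) * V) * l * (ε + 1 - V) ≤ (1 + ε) ^ 2 * (1 - (β - 1) * l) :=
    fun h4 => lemma_U' hβ hβ2.le hε0.le hε1 hVpos h4 hpin
  have hU'2 : V' ≤ 4 * (2 - β) →
      β * ((1 + ε) + (1 - 4 * (2 - β)) * V') * l' * (ε + 1 - V') ≤ (1 + ε) ^ 2 * (1 - (β - 1) * l') :=
    fun h4 => lemma_U' hβ hβ2.le hε0.le hε1 hV'pos h4 hpin'
  have hex : V ≤ 4 * (2 - β) → V' ≤ 4 * (2 - β) → 293 / 100 * Vf ≤ V + V' :=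
    fun h4 h4' => exclusion_sum hβ hβ2 hz1 hl hl1 hl' hl'1 hVpos h4 hV'pos h4' hp hp' hP hVf0 hVP
  have hex' : V' ≤ 4 * (2 - β) → V ≤ 4 * (2 - β) → 293 / 100 * Vf ≤ V' + V :=
    fun h4' h4 => by linarith [hex h4 h4']
  refine ⟨?_, ?_, ?_, ?_⟩
  · -- (I-a): lemma_I on factor 2, times λα ≥ 0
    have := mul_le_mul_of_nonneg_right hI2 hla
    linarith [this]
  · -- (I-b)
    have := mul_le_mul_of_nonneg_right hI1 hl'a
    linarith [this]
  · -- (II-a)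
    exact pair_II hβ hβ2 hzε hε0.le hε1 hla hl'a hVpos hV'pos hU1 hU2 hU'1 hU'2 hex hVf hV'0
  · -- (II-b): the same with the factors exchanged
    have h := pair_II hβ hβ2 hzε hε0.le hε1 hl'a hla hV'pos hVpos hU2 hU1 hU'2 hU'1 hex' hVf hV0
    have e : z * l' * l * (ε + 1 - V') * (ε + 1 - V) = z * l * l' * (ε + 1 - V) * (ε + 1 - V') := by ring
    linarith [h, e]

/-- **XL-D on the corner, for every arity.**  For all `a ≥ 2` and `199/100 ≤ β < 2`: every admissible
schedule satisfies `dev_β ≤ C·(Σ|log λ_i|)^{κ_S}`.  (With kernel XLV this completes the cap law on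
`[37/20, 2]`.) -/
theorem capXLD_allA_corner :
    ∀ a β : ℝ, 2 ≤ a → 199 / 100 ≤ β → β < 2 →
      ∀ R : ℝ, 0 ≤ R → ∀ y₀ : ℝ → ℝ, (∀ b : ℝ, 0 ≤ b → 0 ≤ y₀ b ∧ y₀ b ≤ R / (b + β)) →
        ∃ C : ℝ, ∀ s : Sched, Admissible a β s →
          dev β y₀ s ≤ C * logSize β s ^ (Real.log (4 / 3) / Real.log 2) :=
  capXLD_corner_of_chordConditions chordConditions_corner

end Summit.MatrixMultiplication.MatrixMultiplication.Theorems.FarEdgeDescentCornerSymbolic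

end
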